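import Summits.Ventures.CertifiedQuantumChemistry.Certificates.HubbardRingL6U1000DQGKernel1
import Mathlib.Tactic.Eval
import HarnessLib

/-!
# Ventures/CertifiedQuantumChemistry — Certificates/HubbardRingL6U1000DQGKernel2.lean: KERNEL REPLAY of the DQG lower certificate of
# CERTIFIED row #71 (`hubbardRingTV 6 1 1000`, Hubbard ring L = 6, U/t = 1000, sector (3,3)) — chain part 2 of 5 (see part 1 `Certificates/HubbardRingL6U1000DQGKernel1.lean` for the description)

HONEST FRAMING (verbatim): certified bounds for a stated model Hamiltonian in a stated basis; not a claim about the real molecule beyond that model.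

var-2 (gen 17), zero compute. Continuation of the block-wise kernel replay chain `ringL6U1000DQG_C<i>` (each step: an `eval%` literal
re-checked by `decide +kernel`); the chain is split over files so that no single Lean process holds more than a few steps.
-/

set_option linter.style.longLine false

namespace Summit.Ventures.CertifiedQuantumChemistry

namespace Certificates

open SOSDual CARPoly Summit.Ventures.CertifiedQuantumChemistry.Hamiltonians Literature.MathematicalPhysics.QuantumLattice

set_option maxRecDepth 100000 in
/-- Collected normal form after the block groups `g0 … g7` (elaboration-time literal; checked by `ringL6U1000DQG_C8_ok`). -/
def ringL6U1000DQG_C8 : EncPoly :=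
  eval% encPoly (k := 6) (collect encL 14 (decPoly 6 ringL6U1000DQG_C7 ++ CARPoly.normalize encL 14 (negTerms (gramTermsL 6 40 ringL6U1000DQG_g7))))

set_option maxHeartbeats 4000000 in
/-- KERNEL CHECK of step 8: the literal IS the collected normal form. -/
theorem ringL6U1000DQG_C8_ok : decPoly 6 ringL6U1000DQG_C8 =
    collect encL 14 (decPoly 6 ringL6U1000DQG_C7 ++ CARPoly.normalize encL 14 (negTerms (gramTermsL 6 40 ringL6U1000DQG_g7))) := by
  decide +kernel

set_option maxRecDepth 100000 in
/-- Collected normal form after the block groups `g0 … g8` (elaboration-time literal; checked by `ringL6U1000DQG_C9_ok`). -/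
def ringL6U1000DQG_C9 : EncPoly :=
  eval% encPoly (k := 6) (collect encL 14 (decPoly 6 ringL6U1000DQG_C8 ++ CARPoly.normalize encL 14 (negTerms (gramTermsL 6 40 ringL6U1000DQG_g8))))

set_option maxHeartbeats 4000000 in
/-- KERNEL CHECK of step 9: the literal IS the collected normal form. -/
theorem ringL6U1000DQG_C9_ok : decPoly 6 ringL6U1000DQG_C9 =
    collect encL 14 (decPoly 6 ringL6U1000DQG_C8 ++ CARPoly.normalize encL 14 (negTerms (gramTermsL 6 40 ringL6U1000DQG_g8))) := by
  decide +kernel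

set_option maxRecDepth 100000 in
/-- Collected normal form after the block groups `g0 … g9` (elaboration-time literal; checked by `ringL6U1000DQG_C10_ok`). -/
def ringL6U1000DQG_C10 : EncPoly :=
  eval% encPoly (k := 6) (collect encL 14 (decPoly 6 ringL6U1000DQG_C9 ++ CARPoly.normalize encL 14 (negTerms (gramTermsL 6 40 ringL6U1000DQG_g9))))

set_option maxHeartbeats 4000000 in
/-- KERNEL CHECK of step 10: the literal IS the collected normal form. -/
theorem ringL6U1000DQG_C10_ok : decPoly 6 ringL6U1000DQG_C10 =
    collect encL 14 (decPoly 6 ringL6U1000DQG_C9 ++ CARPoly.normalize encL 14 (negTerms (gramTermsL 6 40 ringL6U1000DQG_g9))) := by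
  decide +kernel

end Certificates

end Summit.Ventures.CertifiedQuantumChemistry
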